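import Summits.BirchSwinnertonDyer.BirchSwinnertonDyer.Theorems.PrintCf2SplitBadTwoRestrictedSelmerKummerInRestricted
import Summits.BirchSwinnertonDyer.BirchSwinnertonDyer.Theorems.PrintCf2SplitBadTwoRestrictedSelmerLocalTrivialAwayFromP
import Summits.BirchSwinnertonDyer.Rank1Residual.X11b.LocSurjFromLevels
import HarnessLib

/-!
# Crux `PrintCf2.SplitBadTwoRankOneOfFacts` (stmt-BirchSwinnertonDyer-20368), road α v10.3, S3c residual (R-BV): THE LOCAL CM INPUT (H1′)
# «the `W*`-component of the Kummer classes dies at `v`» DECIDED BY THE GLOBAL FINITENESS `hfinB′` — a dichotomy-and-exclusion argument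

Cell `bsd-print-cf2`, EXTRA WIDTH seat `bsd-line-cf2-p1-w3` g9 (prover-bsd-line-cf2-p1-w3-g9-0); `--supports stmt-BirchSwinnertonDyer-20368`
(helper, Theses-free). HONEST FRAMING: nothing here closes the crux or a registered stub; (H1′) is proved from DISPLAYED HYPOTHESES; BSD is not
proved by any of this; no summit statement is proved by this seat. No definition, no named fact, no `sorry`, no kit. beyond-print theorem: no.

WHY. -w7 g2's `rBV_of_three_factor_values` (p665606) displays the CM input (H1′) «`Q_M ≤ ker loc_v`» (the `W* = E[𝔮_r^∞]`-components of the
global Kummer classes are locally ZERO at the place `v` where `W*` is pinned), and -w8 g2 reduced the sibling (H1″) to the ANALYTIC statement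
(H1-pts) «`π` acts on `E(K_v) ⊗ ℤ₂ / torsion` as the scalar `1 − r`» (formal-group CM-linearity, typing target T4). THIS FILE replaces the analytic
input by an ALGEBRAIC one plus the level-`K` finiteness the line already carries:
* DICHOTOMY (§1, generic): for a subgroup `Q ≤ H¹(K, E[p^∞])` stable under the projector `ι_* e_*`, consisting of `p`-power torsion classes, and a
  subgroup `H₁ ≤ Γ_K` (a decomposition group) on which the image `loc(Q)` has CYCLIC `p`-torsion (hypothesis (T-loc): «every non-zero
  `x ∈ loc(Q)[p]` generates `loc(Q)[p]`» — for `Q` = the Kummer image and `H₁ = D_v` this is the cyclicity of `(E(K_v) ⊗ ℚ_p/ℤ_p)[p]`, i.e.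
  `E(ℚ₂) ≅ ℤ₂ × finite`), EITHER all `e`-components of `Q` die on `H₁` OR all `e′`-components do (`map_proj_le_ker_or_map_proj_le_ker_of_cyclic`):
  the two component images are disjoint subgroups of a group with at most one line of `p`-torsion.
* EXCLUSION (§2, `K` imaginary quadratic): if the `e′`-components of the Kummer image `Q = res_⊤(range κ)` died at `v`, they would form an
  INFINITE subgroup of Agboola's `𝔖_v(K, W*′)` (strict at `v` by assumption, locally zero away from `p` by -w7's
  `comap_kummer_le_ker_resOfLe_of_not_mem`, nothing at the complex place — `comap_kummer_le_restrictedSelmerBase_of_strict`), contradicting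
  `hfinB′ : Finite 𝔖_v(K, W*′)`. Hence the OTHER branch: **(H1′) `Q_M ≤ ker loc_v` ⟸ hfinB′ ∧ (T-loc at `v`) ∧ (S) ∧ (INF)**
  (`comap_kummer_le_ker_resOfLe_of_finite_conj`), with (S) «`Q` is `ι_* e_*`-stable» and (INF) «`e′_* Q` is infinite» displayed — both
  properties of the global Kummer map (`κ` commutes with `π`; `P`, `πP` are independent), discharged in the sequel. By the symmetry
  `(r, v) ↔ (1 − r, v̄)` the same theorem gives the mirror «`Q_{M′} ≤ ker loc_{v̄}` ⟸ hfinB» used by (F1)/(H2).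

WHAT IS PROVED.
* §0 small algebra: `exists_nsmul_ne_zero_and_smul_eq_zero` (a non-zero `p`-power-torsion element has a multiple of order exactly `p`),
  `not_finite_of_divisible_of_ne_bot` is NOT needed — (INF) is displayed as `¬ Finite`.
* §1 `resH1Hom_proj_resH1Hom_subtype_conj_eq_zero` (`e′_* ∘ ι_* = 0` on `H¹(H₁, ·)`), `map_proj_le_ker_or_map_proj_le_ker_of_cyclic` (DICHOTOMY).
* §2 `comap_le_map_proj` (`ι_*⁻¹ Q ≤ e_* Q`), `map_proj_conj_le_comap_of_stable` (`e′_* Q ≤ ι′_*⁻¹ Q` under (S)),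
  **`comap_kummer_le_ker_resOfLe_of_finite_conj`** ((H1′) from hfinB′ + (T-loc) + (S) + (INF)).

presearch: Agboola 2007 §6 («`E(K_𝔭*) ⊗ D_𝔭 = 0`», arXiv p0014:L5) and Greenberg LNM 1716 Prop. 2.1/§2 (Kummer image = image of `H¹(K_v, C)`)
are the printed routes (formal groups, `p` good ordinary); no printed source decides the component by a global finiteness — nothing to cite beyond
the tree; no Literature fact filed.

References: [Agboola2007] §3, §6 Props. 6.10–6.11; [GreenbergLNM1716] §2 Prop. 2.1, §3; [Rubin1999] §2, Prop. 5.4; [SerreGaloisCohomology1997] I §2.4.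
-/

noncomputable section

open scoped Classical

set_option linter.dupNamespace false
set_option autoImplicit false

open NumberField IsDedekindDomain Field WeierstrassCurve
open Literature.NumberTheory.EllipticCurves Literature.NumberTheory.EllipticCurves.GreenbergSelmer
open Literature.NumberTheory.EllipticCurves.Castella2018.AcSelmer
open Literature.NumberTheory.EllipticCurves.Agboola2007
open Literature.NumberTheory.EllipticCurves.ResKernel
open Literature.NumberTheory.GaloisRepresentations

universe u

namespace Summit.BirchSwinnertonDyer.BirchSwinnertonDyer.Theorems.PrintCf2.RestrictedSelmerPair

open Summit.BirchSwinnertonDyer.Rank1Residual.X11b.Levels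
open Summit.BirchSwinnertonDyer.Rank1Residual.X11b.LocBridge

/-! ## §0. Small algebra -/

section Algebra

variable {A : Type*} [AddCommGroup A] {p : ℕ}

/-- A non-zero element killed by a power of `p` has a multiple which is non-zero and killed by `p`. [folklore] -/
theorem exists_nsmul_ne_zero_and_smul_eq_zero {x : A} (hx : x ≠ 0) {N : ℕ} (hN : p ^ N • x = 0) :
    ∃ j : ℕ, p ^ j • x ≠ 0 ∧ p • (p ^ j • x) = 0 := by
  classical
  have hex : ∃ n : ℕ, p ^ n • x = 0 := ⟨N, hN⟩
  set m := Nat.find hex with hm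
  have hm0 : m ≠ 0 := by
    intro h0
    have := Nat.find_spec hex
    rw [← hm, h0, pow_zero, one_smul] at this
    exact hx this
  obtain ⟨j, hj⟩ := Nat.exists_eq_add_one_of_ne_zero hm0
  refine ⟨j, ?_, ?_⟩
  · have hlt : j < m := by rw [hj]; exact Nat.lt_succ_self j
    exact Nat.find_min hex (by rw [← hm]; exact hlt)
  · rw [smul_smul, ← pow_succ', ← hj]
    exact Nat.find_spec hex

end Algebra

/-! ## §1. The dichotomy: on a group with cyclic `p`-torsion, one of the two component images vanishes -/

section Dichotomy

variable {K : Type u} [Field K] (V : WeierstrassCurve K) (p : ℕ) [Fact p.Prime] (π : V.endRing) (r r' : ℤ_[p])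
  (H₁ : Subgroup (absoluteGaloisGroup K))

/-- **`e′_* ∘ ι_* = 0` on `H¹(H₁, ·)`** for a projector `e′` onto `E[𝔮_{r′}^∞]` vanishing on `E[𝔮_r^∞]` (cocycle level: the composite coefficient
map is zero). [cite: SerreGaloisCohomology1997, I §2.4] -/
theorem resH1Hom_proj_resH1Hom_subtype_conj_eq_zero (e' : V.geomPrimaryTorsion p →+ ↥(V.endEigenPrimaryTorsion p π r'))
    (he'₂ : ∀ x ∈ V.endEigenPrimaryTorsion p π r, e' x = 0)
    (he' : ∀ (σ : absoluteGaloisGroup K) (x : V.geomPrimaryTorsion p), e' (σ • x) = σ • e' x)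
    (a : subgroupH1 H₁ ↥(V.endEigenPrimaryTorsion p π r)) :
    resH1Hom (ContinuousMonoidHom.id H₁) e' (fun σ x ↦ he' σ x)
      (resH1Hom (ContinuousMonoidHom.id H₁) (V.endEigenPrimaryTorsion p π r).subtype (fun _ _ ↦ rfl) a) = 0 := by
  obtain ⟨f, rfl⟩ := oneCocycleClass_surjective _ a
  rw [resH1Hom_oneCocycleClass', resH1Hom_oneCocycleClass']
  have h0 : contOneCocycles.pullback (ContinuousMonoidHom.id H₁)
      (resHomOfEquivariant (ContinuousMonoidHom.id H₁) e' (fun σ x ↦ he' σ x))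
      (contOneCocycles.pullback (ContinuousMonoidHom.id H₁)
        (resHomOfEquivariant (ContinuousMonoidHom.id H₁) (V.endEigenPrimaryTorsion p π r).subtype (fun _ _ ↦ rfl)) f) = 0 := by
    refine Subtype.ext (ContinuousMap.ext fun σ ↦ ?_)
    change e' ((V.endEigenPrimaryTorsion p π r).subtype (f.1 σ)) = 0
    exact he'₂ _ (f.1 σ).2
  rw [h0]
  exact oneCocycleClass_zero _

set_option maxHeartbeats 400000 in
/-- **THE DICHOTOMY.** `V/K` elliptic, `p` prime, complementary eigen-summands `W* = E[𝔮_r^∞]`, `W*′ = E[𝔮_{r′}^∞]` with equivariant projectors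
`e`, `e′` (`e ∘ ι = id`, `e′ ∘ ι′ = id`, `e′ = 0` on `W*`, `ι e + ι′ e′ = id`), `Q ≤ H¹(⊤, E[p^∞])` a subgroup of `p`-power
torsion classes STABLE under `ι_* e_*`, `H₁ ≤ Γ_K`. IF the image `loc(Q) ≤ H¹(H₁, E[p^∞])` has cyclic `p`-torsion ((T-loc): every non-zero
`x ∈ loc(Q)[p]` generates: `y ∈ loc(Q)[p] ⟹ y ∈ ℤ·x`), THEN `e_* Q ≤ ker loc` OR `e′_* Q ≤ ker loc`. Proof: otherwise pick `a ∈ e_* Q`,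
`b ∈ e′_* Q` with non-zero local restrictions; `x = loc(ι_* a)`, `y = loc(ι′_* b)` lie in `loc(Q)` (stability; `ι′_* e′_* q = q − ι_* e_* q`), are
non-zero (`ι_*` injective locally) and `p`-power torsion; pass to multiples of order `p`; (T-loc) gives `y′ = m x′`; apply `e′_*`:
`e′_* y′ = loc b′ ≠ 0` but `e′_* (m x′) = m (e′ ∘ ι)_* a′ = 0`. [cite: GreenbergLNM1716, §2] [cite: Rubin1999, §2] -/
theorem map_proj_le_ker_or_map_proj_le_ker_of_cyclic
    (e : V.geomPrimaryTorsion p →+ ↥(V.endEigenPrimaryTorsion p π r)) (e' : V.geomPrimaryTorsion p →+ ↥(V.endEigenPrimaryTorsion p π r'))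
    (he₁ : ∀ x : ↥(V.endEigenPrimaryTorsion p π r), e x = x)
    (he : ∀ (σ : absoluteGaloisGroup K) (x : V.geomPrimaryTorsion p), e (σ • x) = σ • e x)
    (he'₁ : ∀ x : ↥(V.endEigenPrimaryTorsion p π r'), e' x = x) (he'₂ : ∀ x ∈ V.endEigenPrimaryTorsion p π r, e' x = 0)
    (he' : ∀ (σ : absoluteGaloisGroup K) (x : V.geomPrimaryTorsion p), e' (σ • x) = σ • e' x)
    (hsum : ∀ x, (e x : V.geomPrimaryTorsion p) + (e' x : V.geomPrimaryTorsion p) = x)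
    (Q : AddSubgroup (subgroupH1 (⊤ : Subgroup (absoluteGaloisGroup K)) (V.geomPrimaryTorsion p)))
    (hQtors : ∀ q ∈ Q, ∃ N : ℕ, p ^ N • q = 0)
    (hQstab : ∀ q ∈ Q, resH1Hom (ContinuousMonoidHom.id (⊤ : Subgroup (absoluteGaloisGroup K))) (V.endEigenPrimaryTorsion p π r).subtype (fun _ _ ↦ rfl)
      (resH1Hom (ContinuousMonoidHom.id (⊤ : Subgroup (absoluteGaloisGroup K))) e (fun σ x ↦ he σ x) q) ∈ Q)
    (hle : H₁ ≤ ⊤)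
    (hcyc : ∀ x ∈ Q.map (resOfLe (V.geomPrimaryTorsion p) hle), ∀ y ∈ Q.map (resOfLe (V.geomPrimaryTorsion p) hle),
      p • x = 0 → p • y = 0 → x ≠ 0 → ∃ m : ℤ, y = m • x) :
    Q.map (resH1Hom (ContinuousMonoidHom.id (⊤ : Subgroup (absoluteGaloisGroup K))) e (fun σ x ↦ he σ x)) ≤
        (resOfLe ↥(V.endEigenPrimaryTorsion p π r) hle).ker ∨
      Q.map (resH1Hom (ContinuousMonoidHom.id (⊤ : Subgroup (absoluteGaloisGroup K))) e' (fun σ x ↦ he' σ x)) ≤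
        (resOfLe ↥(V.endEigenPrimaryTorsion p π r') hle).ker := by
  -- notation
  set M := V.geomPrimaryTorsion p with hMdef
  set ιT := resH1Hom (ContinuousMonoidHom.id (⊤ : Subgroup (absoluteGaloisGroup K))) (V.endEigenPrimaryTorsion p π r).subtype
    (fun _ _ ↦ rfl) with hιT
  set ι'T := resH1Hom (ContinuousMonoidHom.id (⊤ : Subgroup (absoluteGaloisGroup K))) (V.endEigenPrimaryTorsion p π r').subtype
    (fun _ _ ↦ rfl) with hι'T
  set eT := resH1Hom (ContinuousMonoidHom.id (⊤ : Subgroup (absoluteGaloisGroup K))) e (fun σ x ↦ he σ x) with heT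
  set e'T := resH1Hom (ContinuousMonoidHom.id (⊤ : Subgroup (absoluteGaloisGroup K))) e' (fun σ x ↦ he' σ x) with he'T
  set ιH := resH1Hom (ContinuousMonoidHom.id H₁) (V.endEigenPrimaryTorsion p π r).subtype (fun _ _ ↦ rfl) with hιH
  set ι'H := resH1Hom (ContinuousMonoidHom.id H₁) (V.endEigenPrimaryTorsion p π r').subtype (fun _ _ ↦ rfl) with hι'H
  set e'H := resH1Hom (ContinuousMonoidHom.id H₁) e' (fun σ x ↦ he' σ x) with he'H
  set loc := resOfLe M hle with hloc
  set locr := resOfLe ↥(V.endEigenPrimaryTorsion p π r) hle with hlocr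
  set locr' := resOfLe ↥(V.endEigenPrimaryTorsion p π r') hle with hlocr'
  by_contra hcon
  rw [not_or] at hcon
  obtain ⟨hA, hB⟩ := hcon
  -- witnesses with non-zero local restriction
  obtain ⟨a, haQ, ha0⟩ : ∃ a ∈ Q.map eT, locr a ≠ 0 := by
    by_contra h
    push Not at h
    exact hA fun a ha ↦ (AddMonoidHom.mem_ker).mpr (h a ha)
  obtain ⟨b, hbQ, hb0⟩ : ∃ b ∈ Q.map e'T, locr' b ≠ 0 := by
    by_contra h
    push Not at h
    exact hB fun b hb ↦ (AddMonoidHom.mem_ker).mpr (h b hb)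
  obtain ⟨qa, hqa, rfl⟩ := AddSubgroup.mem_map.mp haQ
  obtain ⟨qb, hqb, rfl⟩ := AddSubgroup.mem_map.mp hbQ
  -- the splitting `ι_* e_* q + ι′_* e′_* q = q` on `H¹(⊤, E[p^∞])`
  have hsplit : ∀ q, ιT (eT q) + ι'T (e'T q) = q := fun q ↦ resH1Hom_subtype_proj_add_eq V p π r r' ⊤ e e' he he' hsum q
  -- naturality `loc (ι_* c) = ι_*^{H₁} (loc c)` and local injectivity of `ι_*`, `ι′_*`
  have hnat : ∀ c, loc (ιT c) = ιH (locr c) := fun c ↦ resOfLe_resH1Hom_subtype V p π r hle c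
  have hnat' : ∀ c, loc (ι'T c) = ι'H (locr' c) := fun c ↦ resOfLe_resH1Hom_subtype V p π r' hle c
  have hinjH : Function.Injective ιH := resH1Hom_subtype_injective V p π r H₁ e he₁ he
  have hinjH' : Function.Injective ι'H := resH1Hom_subtype_injective V p π r' H₁ e' he'₁ he'
  -- the two local classes
  set x := loc (ιT (eT qa)) with hxdef
  set y := loc (ι'T (e'T qb)) with hydef
  have hx0 : x ≠ 0 := by
    rw [hxdef, hnat]
    exact fun h ↦ ha0 (hinjH (h.trans (map_zero ιH).symm))
  have hy0 : y ≠ 0 := by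
    rw [hydef, hnat']
    exact fun h ↦ hb0 (hinjH' (h.trans (map_zero ι'H).symm))
  -- membership in `loc(Q)` of all multiples
  have hxQ : ∀ n : ℕ, n • x ∈ Q.map loc := fun n ↦ by
    refine AddSubgroup.mem_map.mpr ⟨ιT (eT (n • qa)), hQstab _ (Q.nsmul_mem hqa n), ?_⟩
    rw [map_nsmul, map_nsmul, map_nsmul, hxdef]
  have hyQ : ∀ n : ℕ, n • y ∈ Q.map loc := fun n ↦ by
    have hmem : ι'T (e'T (n • qb)) ∈ Q := by
      have h1 : ι'T (e'T (n • qb)) = n • qb - ιT (eT (n • qb)) := eq_sub_of_add_eq' (hsplit (n • qb))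
      rw [h1]
      exact Q.sub_mem (Q.nsmul_mem hqb n) (hQstab _ (Q.nsmul_mem hqb n))
    refine AddSubgroup.mem_map.mpr ⟨ι'T (e'T (n • qb)), hmem, ?_⟩
    rw [map_nsmul, map_nsmul, map_nsmul, hydef]
  -- `p`-power torsion
  obtain ⟨Na, hNa⟩ := hQtors qa hqa
  obtain ⟨Nb, hNb⟩ := hQtors qb hqb
  have hxN : p ^ Na • x = 0 := by rw [hxdef, ← map_nsmul, ← map_nsmul, ← map_nsmul, hNa, map_zero, map_zero, map_zero]
  have hyN : p ^ Nb • y = 0 := by rw [hydef, ← map_nsmul, ← map_nsmul, ← map_nsmul, hNb, map_zero, map_zero, map_zero]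
  obtain ⟨j, hj0, hjp⟩ := exists_nsmul_ne_zero_and_smul_eq_zero hx0 hxN
  obtain ⟨k, hk0, hkp⟩ := exists_nsmul_ne_zero_and_smul_eq_zero hy0 hyN
  -- (T-loc): the order-`p` multiple of `y` is an integer multiple of the order-`p` multiple of `x`
  obtain ⟨m, hm⟩ := hcyc (p ^ j • x) (hxQ (p ^ j)) (p ^ k • y) (hyQ (p ^ k)) hjp hkp hj0
  -- apply `e′_*^{H₁}`: the left side is `loc (e′_* (p^k qb)) ≠ 0`, the right side is `m • (e′ ∘ ι)_* (…) = 0`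
  have hlhs : e'H (p ^ k • y) = locr' (e'T (p ^ k • qb)) := by
    rw [hydef, ← map_nsmul, ← map_nsmul, ← map_nsmul, hnat']
    have hret := congrArg (fun f ↦ f (locr' (e'T (p ^ k • qb)))) (resH1Hom_proj_comp_subtype V p π r' H₁ e' he'₁ he')
    simpa only [AddMonoidHom.comp_apply, AddMonoidHom.id_apply] using hret
  have hrhs : e'H (m • (p ^ j • x)) = 0 := by
    rw [map_zsmul, hxdef, ← map_nsmul, ← map_nsmul, ← map_nsmul, hnat,
      resH1Hom_proj_resH1Hom_subtype_conj_eq_zero V p π r r' H₁ e' he'₂ he', zsmul_zero]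
  have hzero : locr' (e'T (p ^ k • qb)) = 0 := by rw [← hlhs, hm, hrhs]
  -- contradiction with `p^k • y ≠ 0`
  apply hk0
  rw [hydef, ← map_nsmul, ← map_nsmul, ← map_nsmul, hnat', hzero, map_zero]

end Dichotomy

/-! ## §2. The exclusion on an imaginary quadratic base: (H1′) from `hfinB′` -/

section Exclusion

variable {K : Type u} [Field K] [NumberField K] (V : WeierstrassCurve K) [V.IsElliptic] (p : ℕ) [Fact p.Prime]
  (π : V.endRing) (r r' : ℤ_[p]) (v : HeightOneSpectrum (𝓞 K))

omit [NumberField K] [V.IsElliptic] in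
/-- `ι_*⁻¹ Q ≤ e_* Q` (`c = e_* (ι_* c)`). [cite: SerreGaloisCohomology1997, I §2.4] -/
theorem comap_le_map_proj (e : V.geomPrimaryTorsion p →+ ↥(V.endEigenPrimaryTorsion p π r))
    (he₁ : ∀ x : ↥(V.endEigenPrimaryTorsion p π r), e x = x)
    (he : ∀ (σ : absoluteGaloisGroup K) (x : V.geomPrimaryTorsion p), e (σ • x) = σ • e x)
    (Q : AddSubgroup (subgroupH1 (⊤ : Subgroup (absoluteGaloisGroup K)) (V.geomPrimaryTorsion p))) :
    Q.comap (resH1Hom (ContinuousMonoidHom.id (⊤ : Subgroup (absoluteGaloisGroup K))) (V.endEigenPrimaryTorsion p π r).subtype (fun _ _ ↦ rfl)) ≤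
      Q.map (resH1Hom (ContinuousMonoidHom.id (⊤ : Subgroup (absoluteGaloisGroup K))) e (fun σ x ↦ he σ x)) := by
  intro c hc
  refine AddSubgroup.mem_map.mpr ⟨_, hc, ?_⟩
  have hret := congrArg (fun f ↦ f c) (resH1Hom_proj_comp_subtype V p π r ⊤ e he₁ he)
  simpa only [AddMonoidHom.comp_apply, AddMonoidHom.id_apply] using hret

omit [NumberField K] [V.IsElliptic] in
/-- Under the stability (S) `ι_* e_* Q ⊆ Q`: `e′_* Q ≤ ι′_*⁻¹ Q` (`ι′_* e′_* q = q − ι_* e_* q ∈ Q`). [cite: SerreGaloisCohomology1997, I §2.4] -/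
theorem map_proj_conj_le_comap_of_stable
    (e : V.geomPrimaryTorsion p →+ ↥(V.endEigenPrimaryTorsion p π r)) (e' : V.geomPrimaryTorsion p →+ ↥(V.endEigenPrimaryTorsion p π r'))
    (he : ∀ (σ : absoluteGaloisGroup K) (x : V.geomPrimaryTorsion p), e (σ • x) = σ • e x)
    (he' : ∀ (σ : absoluteGaloisGroup K) (x : V.geomPrimaryTorsion p), e' (σ • x) = σ • e' x)
    (hsum : ∀ x, (e x : V.geomPrimaryTorsion p) + (e' x : V.geomPrimaryTorsion p) = x)
    (Q : AddSubgroup (subgroupH1 (⊤ : Subgroup (absoluteGaloisGroup K)) (V.geomPrimaryTorsion p)))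
    (hQstab : ∀ q ∈ Q, resH1Hom (ContinuousMonoidHom.id (⊤ : Subgroup (absoluteGaloisGroup K))) (V.endEigenPrimaryTorsion p π r).subtype (fun _ _ ↦ rfl)
      (resH1Hom (ContinuousMonoidHom.id (⊤ : Subgroup (absoluteGaloisGroup K))) e (fun σ x ↦ he σ x) q) ∈ Q) :
    Q.map (resH1Hom (ContinuousMonoidHom.id (⊤ : Subgroup (absoluteGaloisGroup K))) e' (fun σ x ↦ he' σ x)) ≤
      Q.comap (resH1Hom (ContinuousMonoidHom.id (⊤ : Subgroup (absoluteGaloisGroup K))) (V.endEigenPrimaryTorsion p π r').subtype (fun _ _ ↦ rfl)) := by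
  rintro _ ⟨q, hq, rfl⟩
  rw [AddSubgroup.mem_comap]
  have h1 := eq_sub_of_add_eq' (resH1Hom_subtype_proj_add_eq V p π r r' ⊤ e e' he he' hsum q)
  rw [h1]
  exact Q.sub_mem hq (hQstab q hq)

/-- **(H1′) FROM `hfinB′` — the branch is decided by the global finiteness.** `V/K` elliptic over an IMAGINARY QUADRATIC `K`, `p` prime, `v` a
finite place, complementary eigen-summands `W* = E[𝔮_r^∞]`, `W*′ = E[𝔮_{r′}^∞]` with projectors `e`, `e′` as in §1, `Q = res_⊤(range κ)` the global
Kummer image. HYPOTHESES: (S) `Q` is `ι_* e_*`-stable; (INF) `e′_* Q` is infinite; (T-loc) `loc_v(Q) ≤ H¹(⊤ ⊓ D_v, E[p^∞])` has cyclic `p`-torsion;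
`hfinB′ : Finite 𝔖_v(K, W*′)`. CONCLUSION: `Q_M = ι_*⁻¹ Q ≤ ker loc_v` — the hypothesis hH1 of `rBV_of_three_factor_values` (per frame). The branch
«`e′_* Q` dies at `v`» would put the infinite `e′_* Q ≤ ι′_*⁻¹ Q` inside `𝔖_v(K, W*′)` (`comap_kummer_le_restrictedSelmerBase_of_strict`).
[cite: Agboola2007, §3, §6 (arXiv p0014:L5)] [cite: GreenbergLNM1716, §2 Prop. 2.1] -/
theorem comap_kummer_le_ker_resOfLe_of_finite_conj (hK : IsImaginaryQuadratic K)
    (hinf : V.endEigenPrimaryTorsion p π r ⊓ V.endEigenPrimaryTorsion p π r' = ⊥)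
    (hsup : V.endEigenPrimaryTorsion p π r ⊔ V.endEigenPrimaryTorsion p π r' = ⊤)
    (e : V.geomPrimaryTorsion p →+ ↥(V.endEigenPrimaryTorsion p π r)) (e' : V.geomPrimaryTorsion p →+ ↥(V.endEigenPrimaryTorsion p π r'))
    (he₁ : ∀ x : ↥(V.endEigenPrimaryTorsion p π r), e x = x)
    (he : ∀ (σ : absoluteGaloisGroup K) (x : V.geomPrimaryTorsion p), e (σ • x) = σ • e x)
    (he'₁ : ∀ x : ↥(V.endEigenPrimaryTorsion p π r'), e' x = x) (he'₂ : ∀ x ∈ V.endEigenPrimaryTorsion p π r, e' x = 0)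
    (he' : ∀ (σ : absoluteGaloisGroup K) (x : V.geomPrimaryTorsion p), e' (σ • x) = σ • e' x)
    (hsum : ∀ x, (e x : V.geomPrimaryTorsion p) + (e' x : V.geomPrimaryTorsion p) = x)
    (hQstab : ∀ q ∈ ((V.kummerMapPInfty p V.zsmul_geomPoints_surjective_holds).range).map (resSubgroup ⊤ (V.geomPrimaryTorsion p)),
      resH1Hom (ContinuousMonoidHom.id (⊤ : Subgroup (absoluteGaloisGroup K))) (V.endEigenPrimaryTorsion p π r).subtype (fun _ _ ↦ rfl)
        (resH1Hom (ContinuousMonoidHom.id (⊤ : Subgroup (absoluteGaloisGroup K))) e (fun σ x ↦ he σ x) q) ∈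
        ((V.kummerMapPInfty p V.zsmul_geomPoints_surjective_holds).range).map (resSubgroup ⊤ (V.geomPrimaryTorsion p)))
    (hQinf : ¬ Finite ↥((((V.kummerMapPInfty p V.zsmul_geomPoints_surjective_holds).range).map
        (resSubgroup ⊤ (V.geomPrimaryTorsion p))).map (resH1Hom (ContinuousMonoidHom.id (⊤ : Subgroup (absoluteGaloisGroup K))) e' (fun σ x ↦ he' σ x))))
    (hcyc : ∀ x ∈ (((V.kummerMapPInfty p V.zsmul_geomPoints_surjective_holds).range).map (resSubgroup ⊤ (V.geomPrimaryTorsion p))).map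
        (resOfLe (V.geomPrimaryTorsion p) (inf_le_left : ⊤ ⊓ decomp v ≤ ⊤)),
      ∀ y ∈ (((V.kummerMapPInfty p V.zsmul_geomPoints_surjective_holds).range).map (resSubgroup ⊤ (V.geomPrimaryTorsion p))).map
        (resOfLe (V.geomPrimaryTorsion p) (inf_le_left : ⊤ ⊓ decomp v ≤ ⊤)),
      p • x = 0 → p • y = 0 → x ≠ 0 → ∃ m : ℤ, y = m • x)
    (hfin' : Finite (restrictedSelmerBase ↥(V.endEigenPrimaryTorsion p π r') p v)) :
    (((V.kummerMapPInfty p V.zsmul_geomPoints_surjective_holds).range).map (resSubgroup ⊤ (V.geomPrimaryTorsion p))).comap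
        (resH1Hom (ContinuousMonoidHom.id (⊤ : Subgroup (absoluteGaloisGroup K))) (V.endEigenPrimaryTorsion p π r).subtype (fun _ _ ↦ rfl)) ≤
      (resOfLe ↥(V.endEigenPrimaryTorsion p π r) (inf_le_left : ⊤ ⊓ decomp v ≤ ⊤)).ker := by
  set Q := ((V.kummerMapPInfty p V.zsmul_geomPoints_surjective_holds).range).map (resSubgroup ⊤ (V.geomPrimaryTorsion p)) with hQdef
  -- `Q` consists of `p`-power torsion classes (`E[p^∞]` is `p`-primary)
  have hQtors : ∀ q ∈ Q, ∃ N : ℕ, p ^ N • q = 0 := by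
    rintro _ ⟨c, -, rfl⟩
    obtain ⟨N, hN⟩ := exists_pow_nsmul_eq_zero_of_primary (primaryGaloisModule V p)
      (fun Q' ↦ AddCommGroup.mem_primaryComponent.mp Q'.2 |>.imp fun k hk ↦
        Subtype.ext (by rw [AddSubmonoidClass.coe_nsmul, hk, ZeroMemClass.coe_zero])) c
    have hN' : p ^ N • (c : V.galH1Primary p) = 0 := hN
    exact ⟨N, by rw [← map_nsmul, hN', map_zero]⟩
  rcases map_proj_le_ker_or_map_proj_le_ker_of_cyclic V p π r r' (⊤ ⊓ decomp v) e e' he₁ he he'₁ he'₂ he' hsum Q hQtors hQstab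
      inf_le_left hcyc with hA | hB
  · exact (comap_le_map_proj V p π r e he₁ he Q).trans hA
  · -- the excluded branch: `e′_* Q ≤ ι′_*⁻¹ Q ≤ 𝔖_v(K, W*′)`, finite — but `e′_* Q` is infinite
    exfalso
    have hstrict : Q.comap (resH1Hom (ContinuousMonoidHom.id (⊤ : Subgroup (absoluteGaloisGroup K))) (V.endEigenPrimaryTorsion p π r').subtype (fun _ _ ↦ rfl)) ≤
        (resOfLe ↥(V.endEigenPrimaryTorsion p π r') (inf_le_left : ⊤ ⊓ decomp v ≤ ⊤)).ker :=
      (comap_le_map_proj V p π r' e' he'₁ he' Q).trans hB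
    have hsel : Q.comap (resH1Hom (ContinuousMonoidHom.id (⊤ : Subgroup (absoluteGaloisGroup K))) (V.endEigenPrimaryTorsion p π r').subtype (fun _ _ ↦ rfl)) ≤
        restrictedSelmerBase ↥(V.endEigenPrimaryTorsion p π r') p v :=
      comap_kummer_le_restrictedSelmerBase_of_strict V p π r' r v hK (by rw [inf_comm]; exact hinf) (by rw [sup_comm]; exact hsup) hstrict
    have hle : Q.map (resH1Hom (ContinuousMonoidHom.id (⊤ : Subgroup (absoluteGaloisGroup K))) e' (fun σ x ↦ he' σ x)) ≤
        restrictedSelmerBase ↥(V.endEigenPrimaryTorsion p π r') p v :=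
      (map_proj_conj_le_comap_of_stable V p π r r' e e' he he' hsum Q hQstab).trans hsel
    haveI := hfin'
    exact hQinf (Finite.of_injective _ (AddSubgroup.inclusion_injective hle))

end Exclusion

end Summit.BirchSwinnertonDyer.BirchSwinnertonDyer.Theorems.PrintCf2.RestrictedSelmerPair

end
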